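import Summits.ResolutionOfSingularities.ResolutionOfSingularities.Theorems.EquisingularLiftEquisingularLiftNatCompleteIntersectionLiftKey
import Summits.ResolutionOfSingularities.ResolutionOfSingularities.Theorems.EquisingularLiftEquisingularLiftNatSaturatedLift
import Literature.AlgebraicGeometry.Motives.ProjectiveSpaceDehomogenize
import HarnessLib

/-!
# [OURS · L1 W4.5(b) · EL♮(3) · WIDTH TABLE D5, (IN-1) brick (B4a)] THE REDUCED TRACE OF A HYPERSURFACE `V₊(G) ⊂ ℙⁿ_k`
# from CHARTWISE RADICALITY of the dehomogenised form: `(G)~ = 𝓘⟨{y | G ∈ 𝔭_y}⟩`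

res-L1-w45b-lead-2 g8 (free hands on the 40th's critical path; desk R59 split of (IN-1), brick (B4) «TRACE from (A2) radicality
chartwise»).  OURS · counted 0 · AI-written, weaker than expert review · nothing of [Hironaka2017] is asserted · EL♮(3) is NOT proved here:
this is pure projective-space plumbing consumed by the (IN-1) joint-birth theorem (hBirth's trace clause for the key model `𝓜`).
No `sorry`, no definition, no instance; standard axioms.  `--supports stmt-ResolutionOfSingularities-20148 --as helper`.

WHAT.  For a family of forms `z : ι → k[x₀,…,xₙ]` (degrees `N`) over a commutative ring / field `k`:
* §1 `rename_succAbove_dehomogenize` — `(dehomogenize k i G)(x_{i.succAbove ·}) = G(xᵢ := 1)` (the (A2) spelling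
  `MvPolynomial.aeval (Function.update X i 1) G` of ✓ `OpeningCertKeyLetter` versus Literature's `ProjectiveSpace.dehomogenize`);
  `isRadical_span_of_retraction` / `isRadical_span_dehomogenize_of_aeval_update` — radicality of `(G(xᵢ := 1))` in `k[x₀,…,xₙ]`
  descends to radicality of `(dehomogenize k i G)` in `k[y₁,…,yₙ]` (retraction `dehomogenize ∘ rename succAbove = id`).
* §2 `isRadical_ideal_basicOpen_projIdealSheaf_span` — on the chart `D₊(xᵢ)` the ideal of `(z)~` is radical as soon as
  `(dehomogenize k i ∘ z)` spans a radical ideal (Mathlib `Proj.basicOpenIsoAway` + Literature ✓ `ProjectiveSpace.chartAlgEquiv`,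
  ✓ `projIdealSheaf_ideal_basicOpen_span`); `isRadical_stalkIdeal_projIdealSheaf_span` — hence RADICAL STALKS (Mathlib
  `IsAffineOpen.isLocalization_stalk`, `IsLocalization.map_radical`, Literature ✓ `stalkIdeal_eq_map_germ`; charts cover by ✓ `SatLift.exists_mem_chart`).
* §3 ★ `projIdealSheaf_span_eq_vanishingIdeal_of_isRadical` — `(z)~ = 𝓘⟨{y | ∀ l, z_l ∈ 𝔭_y}⟩` (✓ `CILift.eq_vanishingIdeal_support_of_forall_radical_le`
  + ✓ `CILift.support_projIdealSheaf_span`); ★ `projIdealSheaf_span_singleton_eq_vanishingIdeal_closure` — the single-form case in hBirth's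
  spelling (`closure {y | G ∈ 𝔭_y}`, (A2) verbatim); ★ `comap_projIdealSheaf_span_singleton_eq_vanishingIdeal_closure` — the UPSTAIRS trace clause
  (M1) of hBirth for any graded `φ` fixing the variables with `φ G̃ = G` (✓ `CILift.comap_projIdealSheaf_span`).
RELATION TO THE TREE.  ✓ `SatLift.projIdealSheaf_eq_vanishingIdeal` (…NatSaturatedLift) gives `I~ = 𝓘⟨V₊(I)⟩` when the HOMOGENEOUS IDEAL `I ≤ k[x]`
is radical; hBirth's certificate (A2) is instead CHARTWISE radicality of the dehomogenised form (what Δ2a's reduced-trace argument and the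
specimen files verify), so this file goes through the charts directly (no «chartwise squarefree ⇒ squarefree» detour).
[cite: Hartshorne1977, II Prop. 2.5, Prop. 5.9, Cor. 5.16] [folklore; radical ideals have radical localisations]
-/

set_option linter.dupNamespace false -- mandated namespace `Summit.<Summit>.<Problem>` of this single-conjunct summit

noncomputable section

open CategoryTheory AlgebraicGeometry TopologicalSpace IsLocalRing
open MvPolynomial HomogeneousLocalization
open Literature.AlgebraicGeometry.Resolution Literature.RingTheory.GradedAlgebra
open Literature.AlgebraicGeometry.Motives

attribute [local instance] MvPolynomial.gradedAlgebra ProjBaseChange.algebraBase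

namespace Summit.ResolutionOfSingularities.ResolutionOfSingularities.Cruxes.EquisingularLiftNat.Sections

namespace HypersurfaceTrace

/-! ## §1 Algebra: `xᵢ := 1` versus dehomogenisation; radicality along a retraction -/

section Algebra

variable {k : Type} [CommRing k] {n : ℕ}

/-- `G(xᵢ := 1) = (dehomogenize k i G)(y ↦ x_{i.succAbove ·})`: the (A2) spelling of the dehomogenised form is the re-embedding of
Literature's `ProjectiveSpace.dehomogenize`. [cite: Hartshorne1977, II Prop. 2.5 (proof)] -/
theorem rename_succAbove_dehomogenize (i : Fin (n + 1)) (G : MvPolynomial (Fin (n + 1)) k) :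
    rename i.succAbove (ProjectiveSpace.dehomogenize k i G) = aeval (Function.update X i (1 : MvPolynomial (Fin (n + 1)) k)) G := by
  have h : ((rename i.succAbove).comp (ProjectiveSpace.dehomogenize k i) :
      MvPolynomial (Fin (n + 1)) k →ₐ[k] MvPolynomial (Fin (n + 1)) k) = aeval (Function.update X i (1 : MvPolynomial (Fin (n + 1)) k)) := by
    apply MvPolynomial.algHom_ext
    intro s
    rcases Fin.eq_self_or_eq_succAbove i s with rfl | ⟨j, rfl⟩
    · rw [AlgHom.comp_apply, ProjectiveSpace.dehomogenize_X_self, map_one, aeval_X, Function.update_self]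
    · rw [AlgHom.comp_apply, ProjectiveSpace.dehomogenize_X_succAbove, rename_X, aeval_X,
        Function.update_of_ne (Fin.succAbove_ne i j)]
  exact AlgHom.congr_fun h G

/-- **Radicality descends along a retraction.** If `φ ∘ ψ = id` and `(ψ '' S)` spans a radical ideal, then `S` spans a radical ideal.
[folklore] -/
theorem isRadical_span_of_retraction {A B : Type*} [CommRing A] [CommRing B] (ψ : A →+* B) (φ : B →+* A)
    (hφψ : ∀ a, φ (ψ a) = a) (S : Set A) (h : (Ideal.span (ψ '' S)).IsRadical) : (Ideal.span S).IsRadical := by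
  intro x hx
  obtain ⟨m, hm⟩ := hx
  have h1 : ψ x ∈ (Ideal.span (ψ '' S)).radical := by
    refine ⟨m, ?_⟩
    have h0 := Ideal.mem_map_of_mem ψ hm
    rwa [map_pow, Ideal.map_span] at h0
  have h2 := Ideal.mem_map_of_mem φ (h h1)
  rw [Ideal.map_span, ← Set.image_comp, hφψ x] at h2
  have hS : (⇑φ ∘ ⇑ψ) '' S = S := by
    have : (⇑φ ∘ ⇑ψ) = id := funext hφψ
    rw [this, Set.image_id]
  rwa [hS] at h2

/-- **(A2) ⇒ chart radicality**: if the forms `G(xᵢ := 1)`, `G ∈ S`, span a radical ideal of `k[x₀,…,xₙ]`, then the dehomogenised forms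
`dehomogenize k i G` span a radical ideal of `k[y₁,…,yₙ]`. [folklore] -/
theorem isRadical_span_dehomogenize_of_aeval_update (i : Fin (n + 1)) (S : Set (MvPolynomial (Fin (n + 1)) k))
    (h : (Ideal.span ((fun G => aeval (Function.update X i (1 : MvPolynomial (Fin (n + 1)) k)) G) '' S)).IsRadical) :
    (Ideal.span (ProjectiveSpace.dehomogenize k i '' S)).IsRadical := by
  refine isRadical_span_of_retraction (A := MvPolynomial (Fin n) k) (B := MvPolynomial (Fin (n + 1)) k)
    (rename i.succAbove : MvPolynomial (Fin n) k →ₐ[k] MvPolynomial (Fin (n + 1)) k).toRingHom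
    (ProjectiveSpace.dehomogenize k i).toRingHom (fun g => ProjectiveSpace.dehomogenize_rename_succAbove k i g)
    (ProjectiveSpace.dehomogenize k i '' S) ?_
  have hS : (⇑(rename i.succAbove : MvPolynomial (Fin n) k →ₐ[k] MvPolynomial (Fin (n + 1)) k).toRingHom) ''
      (ProjectiveSpace.dehomogenize k i '' S) = (fun G => aeval (Function.update X i (1 : MvPolynomial (Fin (n + 1)) k)) G) '' S := by
    rw [← Set.image_comp]
    refine Set.image_congr' fun G => ?_
    exact rename_succAbove_dehomogenize i G
  rwa [hS]

end Algebra

/-! ## §2 The chart `D₊(xᵢ)`: radical ideal of sections, radical stalks -/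

section Chart

variable {k : Type} [CommRing k] {n : ℕ} {ι' : Type*} (z : ι' → MvPolynomial (Fin (n + 1)) k) (N : ι' → ℕ)
  (hz : ∀ l, z l ∈ homogeneousSubmodule (Fin (n + 1)) k (N l)) (hI : (Ideal.span (Set.range z)).IsHomogeneous (homogeneousSubmodule (Fin (n + 1)) k))

/-- The chart algebra isomorphism sends `z_l / xᵢ^{N_l}` to the dehomogenised form `dehomogenize k i z_l`. [cite: Hartshorne1977, II Prop. 2.5] -/
theorem chartAlgEquiv_mk₁ (i : Fin (n + 1)) (l : ι') :
    ProjectiveSpace.chartAlgEquiv k i (mk₁ (homogeneousSubmodule (Fin (n + 1)) k) (ProjectiveSpace.X_mem i) (N l) (z l) (hz l)) =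
      ProjectiveSpace.dehomogenize k i (z l) := by
  change ProjectiveSpace.ofChartRingHom k i (HomogeneousLocalization.Away.mk _ (ProjectiveSpace.X_mem i) (N l) (z l) _) = _
  exact ProjectiveSpace.ofChartRingHom_mk i (N l) (z l) _

include hz in
/-- **Radical chart ideal.** On `D₊(xᵢ)` the ideal of sections of `(z)~` is radical as soon as the dehomogenised forms span a radical ideal
of `k[y₁,…,yₙ]` (transport along `Γ(D₊(xᵢ)) ≅ (k[x]_{xᵢ})₀ ≅ k[y]`). [cite: Hartshorne1977, II Prop. 5.9 (proof)] -/
theorem isRadical_ideal_basicOpen_projIdealSheaf_span (i : Fin (n + 1))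
    (hrad : (Ideal.span (Set.range fun l => ProjectiveSpace.dehomogenize k i (z l))).IsRadical) :
    ((projIdealSheaf (homogeneousSubmodule (Fin (n + 1)) k) ⟨Ideal.span (Set.range z), hI⟩).ideal
      ⟨Proj.basicOpen (homogeneousSubmodule (Fin (n + 1)) k) (X i),
        Proj.isAffineOpen_basicOpen _ (X i) (ProjectiveSpace.X_mem i) one_pos⟩).IsRadical := by
  -- the two ring isomorphisms of the chart
  let e₁ : Away (homogeneousSubmodule (Fin (n + 1)) k) (X i) ≃+*
      Γ(Proj (homogeneousSubmodule (Fin (n + 1)) k), Proj.basicOpen (homogeneousSubmodule (Fin (n + 1)) k) (X i)) :=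
    (Proj.basicOpenIsoAway (homogeneousSubmodule (Fin (n + 1)) k) (X i) (ProjectiveSpace.X_mem i) one_pos).commRingCatIsoToRingEquiv
  let e₂ : Away (homogeneousSubmodule (Fin (n + 1)) k) (X i) ≃+* MvPolynomial (Fin n) k := (ProjectiveSpace.chartAlgEquiv k i).toRingEquiv
  -- the generators in the three rings
  set gA : ι' → Away (homogeneousSubmodule (Fin (n + 1)) k) (X i) := fun l =>
    mk₁ (homogeneousSubmodule (Fin (n + 1)) k) (ProjectiveSpace.X_mem i) (N l) (z l) (hz l) with hgA
  have hKA : Ideal.span (Set.range gA) = Ideal.comap e₂ (Ideal.span (Set.range fun l => ProjectiveSpace.dehomogenize k i (z l))) := by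
    have hfun : (⇑e₂.symm ∘ fun l => ProjectiveSpace.dehomogenize k i (z l)) = gA := by
      funext l
      apply e₂.injective
      change e₂ (e₂.symm _) = e₂ (gA l)
      rw [RingEquiv.apply_symm_apply]
      exact (chartAlgEquiv_mk₁ z N hz i l).symm
    rw [← Ideal.map_symm, Ideal.map_span, ← Set.range_comp, hfun]
  have hradA : (Ideal.span (Set.range gA)).IsRadical := by
    rw [hKA]; exact hrad.comap _
  rw [projIdealSheaf_ideal_basicOpen_span _ z N hz hI (ProjectiveSpace.X_mem i)]
  have hJ : Ideal.span (Set.range fun l => (Proj.awayToSection (homogeneousSubmodule (Fin (n + 1)) k) (X i)).hom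
      (mk₁ (homogeneousSubmodule (Fin (n + 1)) k) (ProjectiveSpace.X_mem i) (N l) (z l) (hz l))) =
      Ideal.comap e₁.symm (Ideal.span (Set.range gA)) := by
    rw [Ideal.comap_symm, Ideal.map_span, ← Set.range_comp]
    rfl
  rw [hJ]
  exact hradA.comap _

include hz in
/-- **Radical stalks.** Under chartwise radicality of the dehomogenised forms, every stalk of `(z)~` at a point of `D₊(xᵢ)` is a radical
ideal of `𝒪_{ℙⁿ,y}` (a localisation of the radical chart ideal). [cite: Hartshorne1977, II Prop. 5.9] -/
theorem isRadical_stalkIdeal_projIdealSheaf_span_of_mem (i : Fin (n + 1)) (y : Proj (homogeneousSubmodule (Fin (n + 1)) k))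
    (hy : y ∈ Proj.basicOpen (homogeneousSubmodule (Fin (n + 1)) k) (X i))
    (hrad : (Ideal.span (Set.range fun l => ProjectiveSpace.dehomogenize k i (z l))).IsRadical) :
    (stalkIdeal (projIdealSheaf (homogeneousSubmodule (Fin (n + 1)) k) ⟨Ideal.span (Set.range z), hI⟩) y).IsRadical := by
  let U : (Proj (homogeneousSubmodule (Fin (n + 1)) k)).affineOpens :=
    ⟨Proj.basicOpen (homogeneousSubmodule (Fin (n + 1)) k) (X i), Proj.isAffineOpen_basicOpen _ (X i) (ProjectiveSpace.X_mem i) one_pos⟩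
  have hJ := isRadical_ideal_basicOpen_projIdealSheaf_span z N hz hI i hrad
  rw [stalkIdeal_eq_map_germ _ U hy]
  letI := (Proj (homogeneousSubmodule (Fin (n + 1)) k)).presheaf.algebra_section_stalk (⟨y, hy⟩ : (U : (Proj (homogeneousSubmodule (Fin (n + 1)) k)).Opens))
  haveI := U.2.isLocalization_stalk ⟨y, hy⟩
  have hmap := IsLocalization.map_radical (U.2.primeIdealOf ⟨y, hy⟩).asIdeal.primeCompl
    ((Proj (homogeneousSubmodule (Fin (n + 1)) k)).presheaf.stalk y)
    (((projIdealSheaf (homogeneousSubmodule (Fin (n + 1)) k) ⟨Ideal.span (Set.range z), hI⟩).ideal U))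
  rw [hJ.radical] at hmap
  -- `algebraMap Γ(D₊(xᵢ)) 𝒪_y` is the germ map by definition of `algebra_section_stalk`
  change (Ideal.map (algebraMap _ ((Proj (homogeneousSubmodule (Fin (n + 1)) k)).presheaf.stalk y)) _).radical ≤
    Ideal.map (algebraMap _ ((Proj (homogeneousSubmodule (Fin (n + 1)) k)).presheaf.stalk y)) _
  rw [← hmap]

end Chart

/-! ## §3 The reduced trace -/

section Trace

variable {k : Type} [Field k] {n : ℕ} {ι' : Type*} (z : ι' → MvPolynomial (Fin (n + 1)) k) (N : ι' → ℕ)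
  (hz : ∀ l, z l ∈ homogeneousSubmodule (Fin (n + 1)) k (N l)) (hI : (Ideal.span (Set.range z)).IsHomogeneous (homogeneousSubmodule (Fin (n + 1)) k))

/-- The support of `(z)~` is the zero locus `{y | ∀ l, z_l ∈ 𝔭_y}` (any index type; CILift's `Fin c` version re-proved verbatim).
[cite: Hartshorne1977, II Prop. 5.9] -/
theorem support_projIdealSheaf_span' :
    ((projIdealSheaf (homogeneousSubmodule (Fin (n + 1)) k) ⟨Ideal.span (Set.range z), hI⟩).support :
        Set (Proj (homogeneousSubmodule (Fin (n + 1)) k))) = {y | ∀ l, z l ∈ y.asHomogeneousIdeal} := by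
  rw [CILift.support_projIdealSheaf_eq]
  ext y
  simp only [Set.mem_setOf_eq]
  change Ideal.span (Set.range z) ≤ y.asHomogeneousIdeal.toIdeal ↔ _
  rw [Ideal.span_le, Set.range_subset_iff]
  rfl

include hz in
/-- ★ **REDUCED TRACE, family form: `(z)~ = 𝓘⟨{y | ∀ l, z_l ∈ 𝔭_y}⟩` on `ℙⁿ_k`** as soon as, on every standard chart, the dehomogenised
forms span a RADICAL ideal of `k[y₁,…,yₙ]`. [cite: Hartshorne1977, II Prop. 5.9, Cor. 5.16] -/
theorem projIdealSheaf_span_eq_vanishingIdeal_of_isRadical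
    (hrad : ∀ i : Fin (n + 1), (Ideal.span (Set.range fun l => ProjectiveSpace.dehomogenize k i (z l))).IsRadical)
    (hSig : IsClosed {y : Proj (homogeneousSubmodule (Fin (n + 1)) k) |
      ∀ l, z l ∈ (y : ProjectiveSpectrum (homogeneousSubmodule (Fin (n + 1)) k)).asHomogeneousIdeal}) :
    projIdealSheaf (homogeneousSubmodule (Fin (n + 1)) k) ⟨Ideal.span (Set.range z), hI⟩ =
      Scheme.IdealSheafData.vanishingIdeal
        ⟨{y : Proj (homogeneousSubmodule (Fin (n + 1)) k) |
          ∀ l, z l ∈ (y : ProjectiveSpectrum (homogeneousSubmodule (Fin (n + 1)) k)).asHomogeneousIdeal}, hSig⟩ := by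
  have hsupp : (⟨{y : Proj (homogeneousSubmodule (Fin (n + 1)) k) |
      ∀ l, z l ∈ (y : ProjectiveSpectrum (homogeneousSubmodule (Fin (n + 1)) k)).asHomogeneousIdeal}, hSig⟩ :
      Closeds (Proj (homogeneousSubmodule (Fin (n + 1)) k))) =
      (projIdealSheaf (homogeneousSubmodule (Fin (n + 1)) k) ⟨Ideal.span (Set.range z), hI⟩).support :=
    Closeds.ext (support_projIdealSheaf_span' z hI).symm
  rw [hsupp]
  refine CILift.eq_vanishingIdeal_support_of_forall_radical_le _ fun y _ => ?_
  obtain ⟨i, hyi⟩ := SatLift.exists_mem_chart y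
  exact isRadical_stalkIdeal_projIdealSheaf_span_of_mem z N hz hI i y hyi (hrad i)

/-- The zero locus of one form is closed. [cite: Hartshorne1977, II §2] -/
theorem isClosed_setOf_mem (G : MvPolynomial (Fin (n + 1)) k) :
    IsClosed {y : Proj (homogeneousSubmodule (Fin (n + 1)) k) | G ∈ (y : ProjectiveSpectrum (homogeneousSubmodule (Fin (n + 1)) k)).asHomogeneousIdeal} := by
  have h := ProjectiveSpectrum.isClosed_zeroLocus (homogeneousSubmodule (Fin (n + 1)) k) ({G} : Set (MvPolynomial (Fin (n + 1)) k))
  have hS : {y : ProjectiveSpectrum (homogeneousSubmodule (Fin (n + 1)) k) | G ∈ y.asHomogeneousIdeal} =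
      ProjectiveSpectrum.zeroLocus (homogeneousSubmodule (Fin (n + 1)) k) {G} :=
    Set.ext fun y => by simp only [ProjectiveSpectrum.mem_zeroLocus, Set.mem_setOf_eq, Set.singleton_subset_iff, SetLike.mem_coe]
  rw [← hS] at h
  exact h

/-- ★ **REDUCED TRACE of one form, hBirth's spelling: `(G)~ = 𝓘⟨closure {y | G ∈ 𝔭_y}⟩` on `ℙⁿ_k` under (A2)**
`∀ i, (G(xᵢ := 1))` radical in `k[x₀,…,xₙ]` (`OpeningCertKeyLetter`'s reduced-trace certificate VERBATIM).  The homogeneity proof `hI` of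
`(G)` is arbitrary (proof-irrelevant). [cite: Hartshorne1977, II Prop. 5.9, Cor. 5.16] -/
theorem projIdealSheaf_span_singleton_eq_vanishingIdeal_closure (G : MvPolynomial (Fin (n + 1)) k) {e : ℕ} (hG : G.IsHomogeneous e)
    (hI : (Ideal.span {G}).IsHomogeneous (homogeneousSubmodule (Fin (n + 1)) k))
    (hA2 : ∀ i : Fin (n + 1), (Ideal.span {MvPolynomial.aeval (Function.update MvPolynomial.X i (1 : MvPolynomial (Fin (n + 1)) k)) G}).IsRadical) :
    projIdealSheaf (homogeneousSubmodule (Fin (n + 1)) k) ⟨Ideal.span {G}, hI⟩ =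
      Scheme.IdealSheafData.vanishingIdeal
        ⟨closure {y : Proj (homogeneousSubmodule (Fin (n + 1)) k) | G ∈ (y : ProjectiveSpectrum (homogeneousSubmodule (Fin (n + 1)) k)).asHomogeneousIdeal},
          isClosed_closure⟩ := by
  -- the one-member family
  have hzr : Set.range (fun _ : Fin 1 => G) = {G} := Set.range_const
  have hIz : (Ideal.span (Set.range fun _ : Fin 1 => G)).IsHomogeneous (homogeneousSubmodule (Fin (n + 1)) k) := by rw [hzr]; exact hI
  have hHI : (⟨Ideal.span {G}, hI⟩ : HomogeneousIdeal (homogeneousSubmodule (Fin (n + 1)) k)) = ⟨Ideal.span (Set.range fun _ : Fin 1 => G), hIz⟩ :=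
    HomogeneousIdeal.toIdeal_injective (by change Ideal.span {G} = Ideal.span (Set.range fun _ : Fin 1 => G); rw [hzr])
  have hSig1 : IsClosed {y : Proj (homogeneousSubmodule (Fin (n + 1)) k) |
      ∀ l : Fin 1, (fun _ : Fin 1 => G) l ∈ (y : ProjectiveSpectrum (homogeneousSubmodule (Fin (n + 1)) k)).asHomogeneousIdeal} := by
    have h := isClosed_setOf_mem G
    refine (congrArg IsClosed ?_).mp h
    exact Set.ext fun y => ⟨fun hy _ => hy, fun hy => hy 0⟩
  have hcl : (⟨closure {y : Proj (homogeneousSubmodule (Fin (n + 1)) k) | G ∈ (y : ProjectiveSpectrum (homogeneousSubmodule (Fin (n + 1)) k)).asHomogeneousIdeal},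
      isClosed_closure⟩ : Closeds (Proj (homogeneousSubmodule (Fin (n + 1)) k))) =
      ⟨{y | ∀ l : Fin 1, (fun _ : Fin 1 => G) l ∈ (y : ProjectiveSpectrum (homogeneousSubmodule (Fin (n + 1)) k)).asHomogeneousIdeal}, hSig1⟩ := by
    apply Closeds.ext
    change closure {y : Proj (homogeneousSubmodule (Fin (n + 1)) k) | G ∈ (y : ProjectiveSpectrum (homogeneousSubmodule (Fin (n + 1)) k)).asHomogeneousIdeal} =
      {y | ∀ l : Fin 1, (fun _ : Fin 1 => G) l ∈ (y : ProjectiveSpectrum (homogeneousSubmodule (Fin (n + 1)) k)).asHomogeneousIdeal}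
    rw [(isClosed_setOf_mem G).closure_eq]
    exact Set.ext fun y => ⟨fun hy _ => hy, fun hy => hy 0⟩
  rw [hHI, hcl]
  refine projIdealSheaf_span_eq_vanishingIdeal_of_isRadical (fun _ : Fin 1 => G) (fun _ => e) (fun _ => hG) hIz (fun i => ?_) hSig1
  have h1 : (Set.range fun _ : Fin 1 => ProjectiveSpace.dehomogenize k i G) = ProjectiveSpace.dehomogenize k i '' {G} := by
    rw [Set.image_singleton]; exact Set.range_const
  rw [h1]
  refine isRadical_span_dehomogenize_of_aeval_update i {G} ?_
  rw [Set.image_singleton]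
  exact hA2 i

/-- ★ **THE UPSTAIRS TRACE CLAUSE (M1) of hBirth**: for a graded `φ : O[x] → k[x]` fixing the variables (e.g. `φ = MvPolynomial.map θ`) and a
θ-lift `G̃` of `G` (`φ G̃ = G`, both homogeneous of degree `e`), under (A2):
`(G̃)~ · 𝒪_{ℙⁿ_k} = 𝓘⟨closure {y | G ∈ 𝔭_y}⟩`. [cite: Hartshorne1977, II Prop. 5.9, Ex. 3.12 (a), Cor. 5.16] -/
theorem comap_projIdealSheaf_span_singleton_eq_vanishingIdeal_closure {O : Type} [CommRing O]
    (φ : (homogeneousSubmodule (Fin (n + 1)) O) →+*ᵍ (homogeneousSubmodule (Fin (n + 1)) k))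
    (hφ' : HomogeneousIdeal.irrelevant (homogeneousSubmodule (Fin (n + 1)) k) ≤ (HomogeneousIdeal.irrelevant (homogeneousSubmodule (Fin (n + 1)) O)).map φ)
    (hφX : ∀ i : Fin (n + 1), φ (X i) = X i)
    (Gt : MvPolynomial (Fin (n + 1)) O) (G : MvPolynomial (Fin (n + 1)) k) {e : ℕ} (hGt : Gt.IsHomogeneous e) (hG : G.IsHomogeneous e) (hφG : φ Gt = G)
    (hIt : (Ideal.span {Gt}).IsHomogeneous (homogeneousSubmodule (Fin (n + 1)) O))
    (hA2 : ∀ i : Fin (n + 1), (Ideal.span {MvPolynomial.aeval (Function.update MvPolynomial.X i (1 : MvPolynomial (Fin (n + 1)) k)) G}).IsRadical) :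
    (projIdealSheaf (homogeneousSubmodule (Fin (n + 1)) O) ⟨Ideal.span {Gt}, hIt⟩).comap (Proj.map φ hφ') =
      Scheme.IdealSheafData.vanishingIdeal
        ⟨closure {y : Proj (homogeneousSubmodule (Fin (n + 1)) k) | G ∈ (y : ProjectiveSpectrum (homogeneousSubmodule (Fin (n + 1)) k)).asHomogeneousIdeal},
          isClosed_closure⟩ := by
  have hIk : (Ideal.span {G}).IsHomogeneous (homogeneousSubmodule (Fin (n + 1)) k) :=
    Ideal.homogeneous_span _ _ fun x hx => by rw [Set.mem_singleton_iff.mp hx]; exact ⟨e, hG⟩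
  -- the one-member families upstairs and downstairs
  have hrt : Set.range (fun _ : Fin 1 => Gt) = {Gt} := Set.range_const
  have hr : Set.range (fun _ : Fin 1 => G) = {G} := Set.range_const
  have hHt : (⟨Ideal.span {Gt}, hIt⟩ : HomogeneousIdeal (homogeneousSubmodule (Fin (n + 1)) O)) =
      ⟨Ideal.span (Set.range fun _ : Fin 1 => Gt), isHomogeneous_span_of_forall_mem _ (fun _ : Fin 1 => Gt) (fun _ => e) (fun _ => hGt)⟩ :=
    HomogeneousIdeal.toIdeal_injective (by change Ideal.span {Gt} = Ideal.span (Set.range fun _ : Fin 1 => Gt); rw [hrt])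
  have hHk : (⟨Ideal.span (Set.range fun _ : Fin 1 => G), isHomogeneous_span_of_forall_mem _ (fun _ : Fin 1 => G) (fun _ => e) (fun _ => hG)⟩ :
      HomogeneousIdeal (homogeneousSubmodule (Fin (n + 1)) k)) = ⟨Ideal.span {G}, hIk⟩ :=
    HomogeneousIdeal.toIdeal_injective (by change Ideal.span (Set.range fun _ : Fin 1 => G) = Ideal.span {G}; rw [hr])
  rw [hHt, CILift.comap_projIdealSheaf_span φ hφ' hφX (fun _ : Fin 1 => Gt) (fun _ : Fin 1 => G) (fun _ => e) (fun _ => hGt) (fun _ => hG) (fun _ => hφG),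
    hHk]
  exact projIdealSheaf_span_singleton_eq_vanishingIdeal_closure G hG hIk hA2

end Trace

end HypersurfaceTrace

end Summit.ResolutionOfSingularities.ResolutionOfSingularities.Cruxes.EquisingularLiftNat.Sections

end
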